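import Literature.NumberTheory.Rogawski1990.AdelicStableOrbitalEulerDischargeG2
import HarnessLib

/-!
# The class orbital integrals on ★ `MatchingAdeleG₂.classes L H₁ H₂ γ₀` are FINITELY SUPPORTED: `(𝒞_𝐀(γ₀) ∩ support Φ_{ofLocalAdelic mq mqi}(·, T.eval)).Finite`
# — the hypothesis `hfin` of ★ `PreStabilisationCountSelf`, discharged for the kit's families (Rogawski 1990, §4.3 p. 44; §5.4 (5.4.2)–(5.4.3) pp. 72–73)

Topic `NumberTheory/Rogawski1990`; namespace `Literature.NumberTheory.Rogawski1990`; **THEOREMS ONLY** (no definition, no named fact, no instance, no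
notation, no `sorry`).  Cell `pub/hodgecm-mathlib`, ENGINE T1 (crux H413 = `stmt-HodgeConjecture-24833`), row O11-1 «regular elliptic pre-stabilisation on
the self carrier» (RULING #100a (1)), census `CENSUS-O11-1-RegularPreStabilisationSelf.v1` §2: the ONE kernel gap between ★ (E1) `FinsumProdReindex` ∕ ★
G2-kernel B∕C (which prove the factorised SUM `Σ_{𝒞_𝐀(γ₀)} Φ = Φ_∞ · ∏_v Φ_v`) and ★ `PreStabilisationCountSelf` (which needs the summand
`δ ↦ Φ_m(δ, f)` FINITELY SUPPORTED on `𝒞_𝐀(γ₀)` to exchange `Σ_κ` with `Σᶠ_δ`).  HC_CM is proved only modulo the printed citations until rung 0 closes.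

[Rogawski1990, §4.3 p. 44]: «almost all factors in the product are equal to `1` … we may therefore set `Φ^κ(γ, f) = Π_v Φ^{κ_v}(γ, f_v)`»; §5.4 p. 72:
«The orbital integral `Φ(γ, f)` depends only on the image of `γ` in `𝒞_𝐀` … (5.4.2) `Σ_{γ ∈ 𝒞_𝐀} Σ_{κ} κ(obs(γ)) Φ(γ, f)`», a FINITE sum: for `f = f_∞ ⊗ ⊗_v f_v`
with `f_v = 1_{K_v}` off a finite `S`, a class `δ ∈ 𝒞_𝐀` with `Φ(δ, f) ≠ 0` has `δ_v =` the base class `[γ_v]` off `S` ([Kottwitz1986, Prop. 7.1]: `Φ_v(δ_v, 1_{K_v}) = 0` on the other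
classes of the local stable class a.e.) and `δ_v`, `δ_∞` in the finite supports of `Φ_v(·, f_v)`, `Φ_∞(·, f_∞)` on the local ∕ archimedean stable classes; by the gluing
(injectivity of `δ ↦ ((δ_v)_v, δ_∞)` on `𝒞_𝐀`) there are finitely many such `δ`.

* §1 GENERIC (★ E1's dictionary `𝒞, π, πₐ, St, e, Stₐ, Φ, φ, φₐ, S`): **`finite_inter_support_of_factor`** — (inj) + (img) + (ev) + (fac) + (h1) + (h0) + finite
  supports on `S` and at `∞` ⇒ `(𝒞 ∩ support Φ).Finite` (the support injects into `(∏_{i ∈ S} support φ_i ∩ St_i) × (support φₐ ∩ Stₐ)`);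
* §2 on the carrier: **`MatchingAdeleG₂.finite_classes_inter_support_of_factor`** — ★ G2-kernel B's finset-form hypotheses `hfac ∕ h1 ∕ h0 ∕ hfin ∕ hfinₐ`
  VERBATIM (for a generic class function `Φ`), dictionary discharged by ★ G2-kernel A (`eq_of_forall_map_toLocal_eq_of_map_archPart_eq`, `corresponds_out_map_*`,
  `eventually_map_toLocal_eq_mk`);
* §3 at the kit's family: **`MatchingAdeleG₂.finite_classes_inter_support_classOrbitalIntegral_ofLocalAdelic`** (★ C's hypotheses VERBATIM: `hadm hadmA hnormγ hnorm T hT hFi`)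
  and **`…_of_isCanonical`** (`mq v` canonical for `ν_v`, `ν_v(K_v) = 1`, `mqi` admissible, `T` an `IsTest` pure tensor — every analytic side condition discharged).

## References
* [Rogawski1990] J. D. Rogawski, *Automorphic Representations of Unitary Groups in Three Variables*, Ann. of Math. Stud. 123 (1990), §4.3 p. 44, §5.4 (5.4.2)–(5.4.3)
  pp. 72–73, §14.5 p. 238.
* [Kottwitz1986] R. E. Kottwitz, *Stable trace formula: elliptic singular terms*, Math. Ann. 275 (1986), Prop. 7.1, §7.3.
-/

set_option autoImplicit false

noncomputable section

open NumberField IsDedekindDomain Filter Function MeasureTheory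
open scoped Matrix MatrixGroups

namespace Literature.NumberTheory.Rogawski1990

open Literature.NumberTheory.Automorphic Literature.MeasureTheory.Group

/-! ## §1 Generic: a factorising summand is finitely supported on the class set -/

section Generic

variable {X : Type*} {ι : Type*} {D : ι → Type*} {B : Type*} {R : Type*} [CommSemiring R]
  (𝒞 : Set X) (π : X → ∀ i, D i) (πₐ : X → B) (St : ∀ i, Set (D i)) (e : ∀ i, D i) (Stₐ : Set B)
  (Φ : X → R) (φ : ∀ i, D i → R) (φₐ : B → R) (S : Finset ι)

/-- **Finite support from the factorisation.**  In ★ E1's dictionary: if `x ↦ (π x, πₐ x)` is injective on `𝒞` (inj), lands in the stable sets (img), `π x i = e i`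
for all but finitely many `i` (ev), `Φ x = φₐ (πₐ x) · ∏ᶠ i, φ i (π x i)` on `𝒞` (fac), and off the finite set `S` each `φ i` is `1` at `e i` (h1) and `0` on
`St i ∖ {e i}` (h0), with `support φ_i ∩ St_i` finite on `S` and `support φₐ ∩ Stₐ` finite, then `𝒞 ∩ support Φ` is finite: a class in the support has
`π x i = e i` off `S`, so it is determined by `((π x i)_{i ∈ S}, πₐ x)`, which ranges in a finite set. [cite: Rogawski1990, §4.3 p. 44; §5.4 (5.4.2) p. 72]
[cite: Kottwitz1986, Prop. 7.1] -/
theorem finite_inter_support_of_factor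
    (hinj : Set.InjOn (fun x => (π x, πₐ x)) 𝒞)
    (himg : ∀ x ∈ 𝒞, (∀ i, π x i ∈ St i) ∧ πₐ x ∈ Stₐ)
    (hev : ∀ x ∈ 𝒞, ∀ᶠ i in cofinite, π x i = e i)
    (hfac : ∀ x ∈ 𝒞, Φ x = φₐ (πₐ x) * ∏ᶠ i, φ i (π x i))
    (h1 : ∀ i ∉ S, φ i (e i) = 1) (h0 : ∀ i ∉ S, ∀ d ∈ St i, d ≠ e i → φ i d = 0)
    (hfin : ∀ i ∈ S, (support (φ i) ∩ St i).Finite) (hfinₐ : (support φₐ ∩ Stₐ).Finite) :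
    (𝒞 ∩ support Φ).Finite := by
  classical
  -- what the support condition forces on a class
  have hbase : ∀ x ∈ 𝒞 ∩ support Φ,
      (∀ i ∉ S, π x i = e i) ∧ (∀ i ∈ S, π x i ∈ support (φ i) ∩ St i) ∧ πₐ x ∈ support φₐ ∩ Stₐ := by
    rintro x ⟨hx, hΦ⟩
    rw [mem_support, hfac x hx] at hΦ
    have ha : φₐ (πₐ x) ≠ 0 := left_ne_zero_of_mul hΦ
    have hp : ∏ᶠ i, φ i (π x i) ≠ 0 := right_ne_zero_of_mul hΦ
    -- the product is a genuine finite product: off `S ∪ {i | π x i ≠ e i}` the factors are `1`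
    have hms : (mulSupport fun i => φ i (π x i)).Finite := by
      refine ((S.finite_toSet).union (Filter.eventually_cofinite.1 (hev x hx))).subset fun i hi => ?_
      by_contra hnot
      simp only [Set.mem_union, Finset.mem_coe, Set.mem_setOf_eq, not_or, not_not] at hnot
      exact hi (show φ i (π x i) = 1 by rw [hnot.2]; exact h1 i hnot.1)
    have hne : ∀ i, φ i (π x i) ≠ 0 := fun i h0i => hp (finprod_eq_zero _ i h0i hms)
    refine ⟨fun i hi => ?_, fun i _ => ⟨hne i, (himg x hx).1 i⟩, ⟨ha, (himg x hx).2⟩⟩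
    by_contra hπ
    exact hne i (h0 i hi (π x i) ((himg x hx).1 i) hπ)
  -- the reading on `S` and at `∞` is injective on the support and ranges in a finite set
  let F : X → (∀ i : ↥S, D i) × B := fun x => (fun i => π x i, πₐ x)
  have hFinj : Set.InjOn F (𝒞 ∩ support Φ) := by
    intro x hx y hy hxy
    have h₁ : (fun i : ↥S => π x i) = fun i : ↥S => π y i := congrArg Prod.fst hxy
    have h₂ : πₐ x = πₐ y := congrArg Prod.snd hxy
    refine hinj hx.1 hy.1 (Prod.ext (funext fun i => ?_) h₂)
    by_cases hi : i ∈ S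
    · exact congrFun h₁ ⟨i, hi⟩
    · show π x i = π y i
      rw [(hbase x hx).1 i hi, (hbase y hy).1 i hi]
  have hFimg : F '' (𝒞 ∩ support Φ) ⊆ (Set.univ.pi fun i : ↥S => support (φ i) ∩ St i) ×ˢ (support φₐ ∩ Stₐ) := by
    rintro _ ⟨x, hx, rfl⟩
    exact ⟨fun i _ => (hbase x hx).2.1 i i.2, (hbase x hx).2.2⟩
  exact Set.Finite.of_finite_image (((Set.Finite.pi fun i : ↥S => hfin i i.2).prod hfinₐ).subset hFimg) hFinj

end Generic

/-! ## §2 On the carrier `𝒞_𝐀(γ₀) ⊂ ConjClasses U(H₂)(𝐀)`: ★ G2-kernel B's finset-form hypotheses -/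

section Carrier

variable {L : Type} [Field L] [NumberField L] [IsCMField L] {H₁ H₂ : Matrix (Fin 3) (Fin 3) L}
  {γ₀ : (UnitaryGroup.cmDatum L 3 H₁).Rational} {γ : (UnitaryGroup.cmDatum L 3 H₂).Rational}

/-- **Finite support on `𝒞_𝐀(γ₀)` from a finset-form factorisation** (the hypotheses of ★ `MatchingAdeleG₂.isEulerOnClasses_of_factor` VERBATIM, for a generic class function
`Φ`): per class `c ∈ 𝒞_𝐀(γ₀)` a finite `S₂` with unit factors off it and `Φ c = φ_∞([(out c)_∞]) · ∏_{v ∈ S₂} φ_v([(out c)_v])`; off `S` the base class `[γ_v]` has unit factor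
and the other classes corresponding to `(γ₀)_v` have factor `0`; finite supports on `S` and at `∞`.  THEN `(𝒞_𝐀(γ₀) ∩ support Φ).Finite` (§1 on the dictionary ★ G2-kernel A:
inj = `eq_of_forall_map_toLocal_eq_of_map_archPart_eq`, img = `corresponds_out_map_toLocal ∕ _archPart`, ev = `eventually_map_toLocal_eq_mk` ([Kt₄] 7.1)).
[cite: Rogawski1990, §4.3 p. 44; §5.4 (5.4.2)–(5.4.3) pp. 72–73] [cite: Kottwitz1986, Prop. 7.1] -/
theorem MatchingAdeleG₂.finite_classes_inter_support_of_factor (hH₂ : (H₂.map (cmConjRingHom L))ᵀ = H₂) (hdet : H₂.det ≠ 0)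
    (hreg : IsRegularElt (γ₀.val : GL (Fin 3) L))
    (hγ : Corresponds (cmConjRingHom L) H₁ H₂ γ₀ γ)
    (Φ : ConjClasses (UnitaryGroup.cmDatum L 3 H₂).Adelic → ℂ)
    (φ : ∀ v : HeightOneSpectrum (𝓞 ↥(maximalRealSubfield L)), ConjClasses ((UnitaryGroup.cmDatum L 3 H₂).Local v) → ℂ)
    (φₐ : ConjClasses (UnitaryGroup.arch (↥(maximalRealSubfield L)) L (IsCMField.complexConj L) 3 H₂) → ℂ)
    (S : Finset (HeightOneSpectrum (𝓞 ↥(maximalRealSubfield L))))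
    (hfac : ∀ c ∈ MatchingAdeleG₂.classes L H₁ H₂ γ₀, ∃ S₂ : Finset (HeightOneSpectrum (𝓞 ↥(maximalRealSubfield L))),
      (∀ v ∉ S₂, φ v (ConjClasses.mk ((UnitaryGroup.cmDatum L 3 H₂).toLocal v (Quotient.out c))) = 1) ∧
      Φ c = φₐ (ConjClasses.mk (UnitaryGroup.archPart (↥(maximalRealSubfield L)) L (IsCMField.complexConj L) 3 H₂ (Quotient.out c))) *
        ∏ v ∈ S₂, φ v (ConjClasses.mk ((UnitaryGroup.cmDatum L 3 H₂).toLocal v (Quotient.out c))))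
    (h1 : ∀ v ∉ S, φ v (ConjClasses.mk ((UnitaryGroup.cmDatum L 3 H₂).toLocal v ((UnitaryGroup.cmDatum L 3 H₂).toAdelic γ))) = 1)
    (h0 : ∀ v ∉ S, ∀ d, Corresponds (UnitaryGroup.conjLocal L (IsCMField.complexConj L) v)
        ((UnitaryGroup.adelicForm L 3 H₁).map (UnitaryGroup.adeleToLocal L v))
        ((UnitaryGroup.adelicForm L 3 H₂).map (UnitaryGroup.adeleToLocal L v))
        ((UnitaryGroup.cmDatum L 3 H₁).toLocal v ((UnitaryGroup.cmDatum L 3 H₁).toAdelic γ₀)) (Quotient.out d) →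
      d ≠ ConjClasses.mk ((UnitaryGroup.cmDatum L 3 H₂).toLocal v ((UnitaryGroup.cmDatum L 3 H₂).toAdelic γ)) → φ v d = 0)
    (hfin : ∀ v ∈ S, (support (φ v) ∩ {d | Corresponds (UnitaryGroup.conjLocal L (IsCMField.complexConj L) v)
        ((UnitaryGroup.adelicForm L 3 H₁).map (UnitaryGroup.adeleToLocal L v))
        ((UnitaryGroup.adelicForm L 3 H₂).map (UnitaryGroup.adeleToLocal L v))
        ((UnitaryGroup.cmDatum L 3 H₁).toLocal v ((UnitaryGroup.cmDatum L 3 H₁).toAdelic γ₀)) (Quotient.out d)}).Finite)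
    (hfinₐ : (support φₐ ∩ {b | Corresponds (UnitaryGroup.conjMixed (↥(maximalRealSubfield L)) L (IsCMField.complexConj L)) (UnitaryGroup.archFormOf L 3 H₁)
        (UnitaryGroup.archFormOf L 3 H₂) (cmRationalToArch L 3 H₁ γ₀) (Quotient.out b)}).Finite) :
    (MatchingAdeleG₂.classes L H₁ H₂ γ₀ ∩ support Φ).Finite := by
  classical
  refine finite_inter_support_of_factor (MatchingAdeleG₂.classes L H₁ H₂ γ₀)
    (fun c v => ConjClasses.map ((UnitaryGroup.cmDatum L 3 H₂).toLocal v) c)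
    (fun c => ConjClasses.map (UnitaryGroup.archPart (↥(maximalRealSubfield L)) L (IsCMField.complexConj L) 3 H₂) c)
    (fun v => {d | Corresponds (UnitaryGroup.conjLocal L (IsCMField.complexConj L) v)
        ((UnitaryGroup.adelicForm L 3 H₁).map (UnitaryGroup.adeleToLocal L v))
        ((UnitaryGroup.adelicForm L 3 H₂).map (UnitaryGroup.adeleToLocal L v))
        ((UnitaryGroup.cmDatum L 3 H₁).toLocal v ((UnitaryGroup.cmDatum L 3 H₁).toAdelic γ₀)) (Quotient.out d)})
    (fun v => ConjClasses.mk ((UnitaryGroup.cmDatum L 3 H₂).toLocal v ((UnitaryGroup.cmDatum L 3 H₂).toAdelic γ)))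
    _ Φ φ φₐ S ?_ ?_ ?_ (fun c hc => ?_) h1 (fun v hv d hd hne => h0 v hv d hd hne) hfin hfinₐ
  · -- (inj) the gluing
    intro c hc c' hc' h
    exact MatchingAdeleG₂.eq_of_forall_map_toLocal_eq_of_map_archPart_eq hH₂ hdet hreg hc hc' (fun v => congrFun (congrArg Prod.fst h) v)
      (congrArg Prod.snd h)
  · -- (img)
    exact fun c hc => ⟨fun v => MatchingAdeleG₂.corresponds_out_map_toLocal hc v, MatchingAdeleG₂.corresponds_out_map_archPart hc⟩
  · -- (ev) [Kt₄] 7.1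
    exact fun c hc => MatchingAdeleG₂.eventually_map_toLocal_eq_mk hH₂ hdet hreg hγ hc
  · -- (fac) the finset-form factorisation read as a `finprod`
    obtain ⟨S₂, hS₂, hc'⟩ := hfac c hc
    rw [hc', conjClasses_map_eq_mk_out]
    congr 1
    simp_rw [conjClasses_map_eq_mk_out]
    refine (finprod_eq_prod_of_mulSupport_subset _ fun v hv => ?_).symm
    rw [Finset.mem_coe]
    by_contra hvS
    exact hv (hS₂ v hvS)

end Carrier

/-! ## §3 At the kit's family `ofLocalAdelic L 3 H₂ mq mqi` and an `IsTest` pure tensor -/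

section OfLocalAdelic

variable {L : Type} [Field L] [NumberField L] [IsCMField L] {H₁ H₂ : Matrix (Fin 3) (Fin 3) L}
  {γ₀ : (UnitaryGroup.cmDatum L 3 H₁).Rational} {γ : (UnitaryGroup.cmDatum L 3 H₂).Rational}
  [∀ g : (UnitaryGroup.cmDatum L 3 H₂).Adelic,
    MeasurableSpace ((UnitaryGroup.cmDatum L 3 H₂).Adelic ⧸ Subgroup.centralizer ({g} : Set (UnitaryGroup.cmDatum L 3 H₂).Adelic))]
  [∀ g : (UnitaryGroup.cmDatum L 3 H₂).Adelic,
    BorelSpace ((UnitaryGroup.cmDatum L 3 H₂).Adelic ⧸ Subgroup.centralizer ({g} : Set (UnitaryGroup.cmDatum L 3 H₂).Adelic))]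
  [∀ (v : HeightOneSpectrum (𝓞 ↥(maximalRealSubfield L))) (x : (UnitaryGroup.cmDatum L 3 H₂).Local v),
    MeasurableSpace ((UnitaryGroup.cmDatum L 3 H₂).Local v ⧸ Subgroup.centralizer ({x} : Set ((UnitaryGroup.cmDatum L 3 H₂).Local v)))]
  [∀ (v : HeightOneSpectrum (𝓞 ↥(maximalRealSubfield L))) (x : (UnitaryGroup.cmDatum L 3 H₂).Local v),
    BorelSpace ((UnitaryGroup.cmDatum L 3 H₂).Local v ⧸ Subgroup.centralizer ({x} : Set ((UnitaryGroup.cmDatum L 3 H₂).Local v)))]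
  [∀ a : UnitaryGroup.arch (↥(maximalRealSubfield L)) L (IsCMField.complexConj L) 3 H₂,
    MeasurableSpace (UnitaryGroup.arch (↥(maximalRealSubfield L)) L (IsCMField.complexConj L) 3 H₂ ⧸
      Subgroup.centralizer ({a} : Set (UnitaryGroup.arch (↥(maximalRealSubfield L)) L (IsCMField.complexConj L) 3 H₂)))]
  [∀ a : UnitaryGroup.arch (↥(maximalRealSubfield L)) L (IsCMField.complexConj L) 3 H₂,
    BorelSpace (UnitaryGroup.arch (↥(maximalRealSubfield L)) L (IsCMField.complexConj L) 3 H₂ ⧸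
      Subgroup.centralizer ({a} : Set (UnitaryGroup.arch (↥(maximalRealSubfield L)) L (IsCMField.complexConj L) 3 H₂)))]

/-- **`(𝒞_𝐀(γ₀) ∩ support Φ_{ofLocalAdelic mq mqi}(·, T.eval)).Finite`** under the hypotheses of ★ `MatchingAdeleG₂.exists_isEulerOnClasses_ofLocalAdelic` VERBATIM (`mq v`, `mqi`
admissible on the regular classes; `mq` normalised off a finite set at `toAdelic γ` and at every matching adèle; `T` an `IsTest` pure tensor with integrable orbital integrand at
every class of `𝒞_𝐀(γ₀)`): §2 with ★ C3 `classOrbitalIntegral_ofLocalAdelic_eval_eq_mul_prod` per class, ★ (S) `eventually_classOrbitalIntegral_indicator_eq_one` (unit factor at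
`[γ_v]` a.e.), ★ `classOrbitalIntegral_indicator_eq_zero_of_corresponds_of_ne₂` ([Kt₄] 7.1: factor `0` on the other classes a.e.), ★ `finite_support_classOrbitalIntegral_inter_corresponds_local₂ ∕
_arch₂`. [cite: Rogawski1990, §4.3 p. 44; §5.4 (5.4.2)–(5.4.3) pp. 72–73] [cite: Kottwitz1986, Prop. 7.1] -/
theorem MatchingAdeleG₂.finite_classes_inter_support_classOrbitalIntegral_ofLocalAdelic (hH₂ : (H₂.map (cmConjRingHom L))ᵀ = H₂) (hdet : H₂.det ≠ 0)
    (hreg : IsRegularElt (γ₀.val : GL (Fin 3) L))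
    (hγ : Corresponds (cmConjRingHom L) H₁ H₂ γ₀ γ)
    (mq : ∀ v : HeightOneSpectrum (𝓞 ↥(maximalRealSubfield L)), OrbitalMeasureFamily ((UnitaryGroup.cmDatum L 3 H₂).Local v))
    (mqi : OrbitalMeasureFamily (UnitaryGroup.arch (↥(maximalRealSubfield L)) L (IsCMField.complexConj L) 3 H₂))
    (hadm : ∀ v, (mq v).IsAdmissibleOn fun x => IsRegularElt (x.val : GL (Fin 3) (UnitaryGroup.LocalRing L v)))
    (hadmA : mqi.IsAdmissibleOn fun a => IsRegularElt (a.val : GL (Fin 3) (mixedEmbedding.mixedSpace L)))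
    (hnormγ : ∃ S₀ : Finset (HeightOneSpectrum (𝓞 ↥(maximalRealSubfield L))),
      UnitaryGroup.IsNormalisedOff L 3 H₂ mq ((UnitaryGroup.cmDatum L 3 H₂).toAdelic γ) S₀)
    (hnorm : ∀ p : MatchingAdeleG₂ L H₁ H₂ γ₀, ∃ S₀ : Finset (HeightOneSpectrum (𝓞 ↥(maximalRealSubfield L))),
      UnitaryGroup.IsNormalisedOff L 3 H₂ mq p.adele S₀)
    (T : UnitaryGroup.PureTensor L 3 H₂) (hT : T.IsTest)
    (hFi : ∀ c ∈ MatchingAdeleG₂.classes L H₁ H₂ γ₀, Integrable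
      (descConj (Quotient.out c : (UnitaryGroup.cmDatum L 3 H₂).Adelic)
        (Subgroup.centralizer ({(Quotient.out c : (UnitaryGroup.cmDatum L 3 H₂).Adelic)} : Set (UnitaryGroup.cmDatum L 3 H₂).Adelic))
        (centralizer_comm _) T.eval)
      (UnitaryGroup.OrbitalMeasureFamily.ofLocalAdelic L 3 H₂ mq mqi c)) :
    (MatchingAdeleG₂.classes L H₁ H₂ γ₀ ∩
      support fun δ => classOrbitalIntegral (UnitaryGroup.OrbitalMeasureFamily.ofLocalAdelic L 3 H₂ mq mqi) T.eval δ).Finite := by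
  classical
  -- abbreviations for the regularity of `γ` and of its components
  have hγreg : IsRegularElt (γ.val : GL (Fin 3) L) := isRegularElt_of_isConj hγ hreg
  have hγv : ∀ v : HeightOneSpectrum (𝓞 ↥(maximalRealSubfield L)),
      IsRegularElt (((UnitaryGroup.cmDatum L 3 H₂).toLocal v ((UnitaryGroup.cmDatum L 3 H₂).toAdelic γ)).val :
        GL (Fin 3) (UnitaryGroup.LocalRing L v)) := fun v =>
    (hγreg.map (algebraMap L (AdeleRing (𝓞 L) L))).map (UnitaryGroup.adeleToLocal L v)
  -- regularity of anything corresponding to `(γ₀)_v`, and of class representatives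
  have hregcorr : ∀ v (x : (UnitaryGroup.cmDatum L 3 H₂).Local v),
      Corresponds (UnitaryGroup.conjLocal L (IsCMField.complexConj L) v)
        ((UnitaryGroup.adelicForm L 3 H₁).map (UnitaryGroup.adeleToLocal L v))
        ((UnitaryGroup.adelicForm L 3 H₂).map (UnitaryGroup.adeleToLocal L v))
        ((UnitaryGroup.cmDatum L 3 H₁).toLocal v ((UnitaryGroup.cmDatum L 3 H₁).toAdelic γ₀)) x →
      IsRegularElt (x.val : GL (Fin 3) (UnitaryGroup.LocalRing L v)) := fun v x hx =>
    isRegularElt_of_isConj ((corresponds_toLocal_toAdelic hγ v).isStablyConj_right hx) (hγv v)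
  have hregout : ∀ v (x : (UnitaryGroup.cmDatum L 3 H₂).Local v),
      IsRegularElt (x.val : GL (Fin 3) (UnitaryGroup.LocalRing L v)) →
      IsRegularElt ((Quotient.out (ConjClasses.mk x) : (UnitaryGroup.cmDatum L 3 H₂).Local v).val : GL (Fin 3) (UnitaryGroup.LocalRing L v)) :=
    fun v x hx => isRegularElt_of_isConj ((UnitaryGroup.«local» L (IsCMField.complexConj L) 3 H₂ v).subtype.map_isConj (isConj_out_conjClasses_mk x)) hx
  -- admissibility triples at a regular local point
  have hadmAt : ∀ v (x : (UnitaryGroup.cmDatum L 3 H₂).Local v), IsRegularElt (x.val : GL (Fin 3) (UnitaryGroup.LocalRing L v)) →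
      mq v (ConjClasses.mk x) ≠ 0 ∧ SMulInvariantMeasure _ _ (mq v (ConjClasses.mk x)) ∧ IsFiniteMeasureOnCompacts (mq v (ConjClasses.mk x)) :=
    fun v x hx => hadm v (ConjClasses.mk x) (hregout v x hx)
  -- (1) the [Kt₄]-7.1 places: the RELATIVE theorem on `U(H₂)` made absolute at the integral base point `γ_v`
  have hKCev : ∀ᶠ v in cofinite, ∀ g : (UnitaryGroup.cmDatum L 3 H₂).Local v, g ∈ UnitaryGroup.cmLocalIntegralLevel L 3 H₂ v →
      Corresponds (UnitaryGroup.conjLocal L (IsCMField.complexConj L) v)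
          ((UnitaryGroup.adelicForm L 3 H₁).map (UnitaryGroup.adeleToLocal L v))
          ((UnitaryGroup.adelicForm L 3 H₂).map (UnitaryGroup.adeleToLocal L v))
          ((UnitaryGroup.cmDatum L 3 H₁).toLocal v ((UnitaryGroup.cmDatum L 3 H₁).toAdelic γ₀)) g →
        ∃ k ∈ UnitaryGroup.cmLocalIntegralLevel L 3 H₂ v,
          k * (UnitaryGroup.cmDatum L 3 H₂).toLocal v ((UnitaryGroup.cmDatum L 3 H₂).toAdelic γ) * k⁻¹ = g := by
    filter_upwards [MatchingAdeleG₂.eventually_forall_exists_conj hH₂ hdet hreg,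
      eventually_toLocal_mem_cmLocalIntegralLevel ((UnitaryGroup.cmDatum L 3 H₂).toAdelic γ)] with v hv hγint g hg hcg
    exact hv _ g hγint hg (corresponds_toLocal_toAdelic hγ v) hcg
  have hKfin := Filter.eventually_cofinite.1 hKCev
  -- (2) the unit-factor places at the base class `[γ_v]` (★ (S), fact-free at hermitian non-degenerate `H₂`)
  obtain ⟨S₀γ, hS₀γ⟩ := hnormγ
  have hunit := UnitaryGroup.eventually_classOrbitalIntegral_indicator_eq_one L 3 H₂ mq
    (UnitaryGroup.unramifiedOrbitSetAE_of_hermitian L 3 H₂ hH₂ hdet) γ hγreg (fun v => (hadmAt v _ (hγv v)).2.1) hS₀γ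
  have hUfin := Filter.eventually_cofinite.1 hunit
  -- the exceptional finite set of places
  set S : Finset (HeightOneSpectrum (𝓞 ↥(maximalRealSubfield L))) := T.S ∪ hKfin.toFinset ∪ hUfin.toFinset with hSdef
  have hS_T : ∀ v ∉ S, v ∉ T.S := fun v hv h => hv (Finset.mem_union_left _ (Finset.mem_union_left _ h))
  have hS_K : ∀ v ∉ S, ∀ g : (UnitaryGroup.cmDatum L 3 H₂).Local v, g ∈ UnitaryGroup.cmLocalIntegralLevel L 3 H₂ v →
      Corresponds (UnitaryGroup.conjLocal L (IsCMField.complexConj L) v)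
          ((UnitaryGroup.adelicForm L 3 H₁).map (UnitaryGroup.adeleToLocal L v))
          ((UnitaryGroup.adelicForm L 3 H₂).map (UnitaryGroup.adeleToLocal L v))
          ((UnitaryGroup.cmDatum L 3 H₁).toLocal v ((UnitaryGroup.cmDatum L 3 H₁).toAdelic γ₀)) g →
        ∃ k ∈ UnitaryGroup.cmLocalIntegralLevel L 3 H₂ v,
          k * (UnitaryGroup.cmDatum L 3 H₂).toLocal v ((UnitaryGroup.cmDatum L 3 H₂).toAdelic γ) * k⁻¹ = g := by
    intro v hv
    by_contra hnot
    exact hv (Finset.mem_union_left _ (Finset.mem_union_right _ (hKfin.mem_toFinset.2 hnot)))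
  have hS_U : ∀ v ∉ S, classOrbitalIntegral (mq v)
      ((UnitaryGroup.cmLocalIntegralLevel L 3 H₂ v : Set ((UnitaryGroup.cmDatum L 3 H₂).Local v)).indicator fun _ => (1 : ℂ))
      (ConjClasses.mk ((UnitaryGroup.cmDatum L 3 H₂).toLocal v ((UnitaryGroup.cmDatum L 3 H₂).toAdelic γ))) = 1 := by
    intro v hv
    by_contra hnot
    exact hv (Finset.mem_union_right _ (hUfin.mem_toFinset.2 hnot))
  refine MatchingAdeleG₂.finite_classes_inter_support_of_factor hH₂ hdet hreg hγ _ (fun v => classOrbitalIntegral (mq v) (T.loc v))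
    (classOrbitalIntegral mqi T.arch) S (fun c hc => ?_) (fun v hv => ?_) (fun v hv d hd hne => ?_) (fun v _ => ?_) ?_
  · -- (fac) ★ C3 at the class `c`, unit factors off `S ∪ {v | local class of c ≠ [γ_v]}`
    obtain ⟨p, rfl⟩ := hc
    -- `out [p]` is the adèle of a matching adèle
    let q : MatchingAdeleG₂ L H₁ H₂ γ₀ := p.conj (Quotient.out (ConjClasses.mk p.adele)) (isConj_out_conjClasses_mk p.adele)
    have hq : q.adele = Quotient.out (ConjClasses.mk p.adele) := rfl
    obtain ⟨S₀, hS₀⟩ := hnorm q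
    have hev := MatchingAdeleG₂.eventually_map_toLocal_eq_mk hH₂ hdet hreg hγ (MatchingAdeleG₂.mk_adele_mem_classes p)
    have hevfin := Filter.eventually_cofinite.1 hev
    -- the unit-factor statement off `S ∪ S_ev(c)`, read with `out [p]`
    have hunit' : ∀ v ∉ S ∪ hevfin.toFinset, classOrbitalIntegral (mq v) (T.loc v)
        (ConjClasses.mk ((UnitaryGroup.cmDatum L 3 H₂).toLocal v (Quotient.out (ConjClasses.mk p.adele)))) = 1 := by
      intro v hv
      have hvS : v ∉ S := fun h => hv (Finset.mem_union_left _ h)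
      have hvE : ConjClasses.map ((UnitaryGroup.cmDatum L 3 H₂).toLocal v) (ConjClasses.mk p.adele) =
          ConjClasses.mk ((UnitaryGroup.cmDatum L 3 H₂).toLocal v ((UnitaryGroup.cmDatum L 3 H₂).toAdelic γ)) := by
        by_contra hnot
        exact hv (Finset.mem_union_right _ (hevfin.mem_toFinset.2 hnot))
      rw [← conjClasses_map_eq_mk_out ((UnitaryGroup.cmDatum L 3 H₂).toLocal v) (ConjClasses.mk p.adele), hvE, (hT.isUnramified).loc_eq (hS_T v hvS)]
      exact hS_U v hvS
    refine ⟨S ∪ hevfin.toFinset, hunit', ?_⟩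
    rw [hq] at hS₀
    exact UnitaryGroup.classOrbitalIntegral_ofLocalAdelic_eval_eq_mul_prod L 3 _ mq mqi (ConjClasses.mk p.adele) hS₀
      (fun v => hadmAt v _ (hregcorr v _ (by rw [← hq]; exact q.corresponds_toLocal v)))
      (hadmA _ (isRegularElt_of_isConj
        ((UnitaryGroup.arch (↥(maximalRealSubfield L)) L (IsCMField.complexConj L) 3 H₂).subtype.map_isConj (isConj_out_conjClasses_mk _))
        (isRegularElt_of_isConj ((corresponds_cmRationalToArch hγ).isStablyConj_right (by rw [← hq]; exact q.corresponds_arch))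
          (hγreg.map (mixedEmbedding L)))))
      T (S ∪ hevfin.toFinset) hT.isUnramified (hFi _ (MatchingAdeleG₂.mk_adele_mem_classes p)) hunit'
  · -- (h1) the base class has unit factor off `S`
    rw [(hT.isUnramified).loc_eq (hS_T v hv)]
    exact hS_U v hv
  · -- (h0) off `S` the other classes of the local stable class have factor `0`
    rw [(hT.isUnramified).loc_eq (hS_T v hv)]
    exact classOrbitalIntegral_indicator_eq_zero_of_corresponds_of_ne₂ v (hS_K v hv) (mq v) d hd hne
  · -- (hfin)
    exact finite_support_classOrbitalIntegral_inter_corresponds_local₂ hH₂ hdet hreg hγ v (mq v)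
      (UnitaryGroup.PureTensor.hasCompactSupport_loc hT.isUnramified hT.isFinSmooth v)
  · -- (hfinₐ)
    exact finite_support_classOrbitalIntegral_inter_corresponds_arch₂ hH₂ hdet hreg hγ mqi hT.isArchTest.hasCompactSupport_arch

variable
  [∀ v : HeightOneSpectrum (𝓞 ↥(maximalRealSubfield L)), MeasurableSpace ((UnitaryGroup.cmDatum L 3 H₂).Local v)]
  [∀ v : HeightOneSpectrum (𝓞 ↥(maximalRealSubfield L)), BorelSpace ((UnitaryGroup.cmDatum L 3 H₂).Local v)]

/-- **… FOR CANONICAL `mq` — every analytic hypothesis discharged** (the hypotheses of ★ `MatchingAdeleG₂.exists_isEulerOnClasses_ofLocalAdelic_of_isCanonical` VERBATIM):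
`mq v` canonical on the regular classes for local Haar measures `ν_v` with `ν_v(K_v) = 1`, `mqi` admissible on the regular archimedean classes, `T` an `IsTest` pure tensor ⇒
`(𝒞_𝐀(γ₀) ∩ support Φ_{ofLocalAdelic mq mqi}(·, T.eval)).Finite` — the `hfin` of ★ `PreStabilisationCountSelf` at the kit's family (`H₁ = H₂`, `γ = γ₀`).
[cite: Rogawski1990, §4.3 pp. 43–44; §5.4 (5.4.2)–(5.4.3) pp. 72–73] [cite: Kottwitz1986, Prop. 7.1] -/
theorem MatchingAdeleG₂.finite_classes_inter_support_classOrbitalIntegral_ofLocalAdelic_of_isCanonical (hH₂ : (H₂.map (cmConjRingHom L))ᵀ = H₂)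
    (hdet : H₂.det ≠ 0) (hreg : IsRegularElt (γ₀.val : GL (Fin 3) L)) (hγ : Corresponds (cmConjRingHom L) H₁ H₂ γ₀ γ)
    (ν : ∀ v : HeightOneSpectrum (𝓞 ↥(maximalRealSubfield L)), Measure ((UnitaryGroup.cmDatum L 3 H₂).Local v))
    [∀ v, (ν v).IsHaarMeasure] [∀ v, (ν v).IsMulRightInvariant]
    (hν : ∀ v, ν v (UnitaryGroup.cmLocalIntegralLevel L 3 H₂ v) = 1)
    (mq : ∀ v : HeightOneSpectrum (𝓞 ↥(maximalRealSubfield L)), OrbitalMeasureFamily ((UnitaryGroup.cmDatum L 3 H₂).Local v))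
    (hcan : ∀ v, (mq v).IsCanonical (fun x => IsRegularElt (x.val : GL (Fin 3) (UnitaryGroup.LocalRing L v))) (ν v))
    (mqi : OrbitalMeasureFamily (UnitaryGroup.arch (↥(maximalRealSubfield L)) L (IsCMField.complexConj L) 3 H₂))
    (hadmA : mqi.IsAdmissibleOn fun a => IsRegularElt (a.val : GL (Fin 3) (mixedEmbedding.mixedSpace L)))
    (T : UnitaryGroup.PureTensor L 3 H₂) (hT : T.IsTest) :
    (MatchingAdeleG₂.classes L H₁ H₂ γ₀ ∩
      support fun δ => classOrbitalIntegral (UnitaryGroup.OrbitalMeasureFamily.ofLocalAdelic L 3 H₂ mq mqi) T.eval δ).Finite := by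
  have hγreg : IsRegularElt (γ.val : GL (Fin 3) L) := isRegularElt_of_isConj hγ hreg
  have hγv : ∀ v : HeightOneSpectrum (𝓞 ↥(maximalRealSubfield L)),
      IsRegularElt (((UnitaryGroup.cmDatum L 3 H₂).toLocal v ((UnitaryGroup.cmDatum L 3 H₂).toAdelic γ)).val :
        GL (Fin 3) (UnitaryGroup.LocalRing L v)) := fun v =>
    (hγreg.map (algebraMap L (AdeleRing (𝓞 L) L))).map (UnitaryGroup.adeleToLocal L v)
  have hregcorr : ∀ v (x : (UnitaryGroup.cmDatum L 3 H₂).Local v),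
      Corresponds (UnitaryGroup.conjLocal L (IsCMField.complexConj L) v)
        ((UnitaryGroup.adelicForm L 3 H₁).map (UnitaryGroup.adeleToLocal L v)) ((UnitaryGroup.adelicForm L 3 H₂).map (UnitaryGroup.adeleToLocal L v))
        ((UnitaryGroup.cmDatum L 3 H₁).toLocal v ((UnitaryGroup.cmDatum L 3 H₁).toAdelic γ₀)) x →
      IsRegularElt (x.val : GL (Fin 3) (UnitaryGroup.LocalRing L v)) := fun v x hx =>
    isRegularElt_of_isConj ((corresponds_toLocal_toAdelic hγ v).isStablyConj_right hx) (hγv v)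
  have hregout : ∀ v (x : (UnitaryGroup.cmDatum L 3 H₂).Local v), IsRegularElt (x.val : GL (Fin 3) (UnitaryGroup.LocalRing L v)) →
      IsRegularElt ((Quotient.out (ConjClasses.mk x) : (UnitaryGroup.cmDatum L 3 H₂).Local v).val : GL (Fin 3) (UnitaryGroup.LocalRing L v)) :=
    fun v x hx => isRegularElt_of_isConj ((UnitaryGroup.«local» L (IsCMField.complexConj L) 3 H₂ v).subtype.map_isConj (isConj_out_conjClasses_mk x)) hx
  have hF : UnitaryGroup.CompactCoreCentralizerLevelAE L 3 H₂ := UnitaryGroup.compactCoreCentralizerLevelAE_of_hermitian L 3 H₂ hH₂ hdet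
  have hnorm : ∀ p : MatchingAdeleG₂ L H₁ H₂ γ₀, ∃ S₀ : Finset (HeightOneSpectrum (𝓞 ↥(maximalRealSubfield L))),
      UnitaryGroup.IsNormalisedOff L 3 H₂ mq p.adele S₀ := fun p =>
    MatchingAdeleG₂.exists_isNormalisedOff hH₂ hdet hreg hγ _ ν hν mq hcan p fun v => hregout v _ (hregcorr v _ (p.corresponds_toLocal v))
  exact MatchingAdeleG₂.finite_classes_inter_support_classOrbitalIntegral_ofLocalAdelic hH₂ hdet hreg hγ mq mqi (fun v => (hcan v).isAdmissibleOn) hadmA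
    (UnitaryGroup.exists_isNormalisedOff_of_isCanonical L 3 H₂ _ ν hν mq hcan hF γ hγreg fun v => hregout v _ (hγv v)) hnorm T hT
    (MatchingAdeleG₂.integrable_descConj_ofLocalAdelic_of_mem_classes hH₂ hdet hreg mq mqi (fun v => (hcan v).isAdmissibleOn) hadmA hnorm T hT)

end OfLocalAdelic

end Literature.NumberTheory.Rogawski1990

end
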